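import Summits.QuantumFields.BalabanUV.Beta.D1BFx.RWeightedLegPackSymm

/-!
# `BalabanUV.Beta.D1BFx.RWeightedLegPackReadout` — road «BF-x», binder row D1, slot (K), debt X₃(ii) ROUTE T, `K-ASSEMBLY-SPEC-v2.md` §1 brick
# **3b-P «THE PACKED N-LEG»**, PART 3 (of 3): THE READ-OUT OF THE MIXED BLOCKS IN THE ROAD'S LANGUAGE — the fm block of
# `NlegK n Ga Cm a′` at a coarse column `w ∈ n•ℤ⁴` IS `LandauDictionaryH.HRcol n Ga Cm l (w∕n)` (the R-weighted minimiser column `Ga𝒬ᵀCm`),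
# the mf block is its transpose, and AT THE ROAD'S LEGS — modulo the two PRINTED statements [B5, Prop. 1.2] ∧ [B5, (1.126)–(1.127)] by name —
# the fm block IS `wH κ l (x − n•y₀)`, the fm block of the typed sharp resolvent `KInv` (`OneStepResolventKernel.KInv_inl_inr_coarse`)

WHY (`K-ASSEMBLY-SPEC-v2.md` §1 row 3b-P «dictionary read-out», K-R1-SPEC v2 §2 (D-H); owner GO ρ-g6-6).  PART 1 built `ℋ_R` as the
composition `Gp Ga ∘ (Qp n)ᵀ ∘ Cp n Cm` so that 3c can periodise it factor by factor; this file identifies that composition, entry by entry, with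
the road's operator-language object `HRcol n Ga Cm l y₀ = kerOp₁ Ga (𝒬ᵀ (Cm-column (l, y₀)))` (B6) — the one place where the 𝒬∕𝒬ᵀ adjointness
(`KKTFluctuationEnergy.lip1_contourSumAdj` on an indicator, `BorderedHessian.lip1_delta1_left`) is spent — and then imports the dictionary
`wH = HRcol n Ga Cun′ l 0` (`LandauResolventSuperpositionRight.wH_eq_HRcol_of_X1a`, X₁b discharged) at the road's legs.
CONTENT (d = 3, block side `n ≥ 1`; all [folklore]):
* §1 vanishing of the other summands in the fm slot: `comp_inl_row_zero`, `sandP_inl_inr`, `HRbp_inl_inr`, `NlegK_inl_inr_eq_HRp`.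
* §2 THE INNER WEIGHT: **`trKQp_Cp_inl_inr`** — `(Qpᵀ ∘ Cp)(z, w; inl m, inr l) = contourSumAdj n (fun m′ y => Cm y (quo n w) m′ l) m z` for
  `w ∈ n•ℤ⁴` (re-indexing the fine sum over the sublattice, `Function.Injective.tsum_eq`; adjointness), `= 0` off the sublattice.
* §3 **`HRp_inl_inr`**, **`NlegK_inl_inr : NlegK n Ga Cm a′ x w (inl κ) (inr l) = if proj n w = 0 then HRcol n Ga Cm l (quo n w) κ x else 0`**
  (needs only `Decays Cm` — boundedness of the coarse column), **`NlegK_inr_inl`** (the mf block, by `trK_NlegK`).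
* §4 AT THE ROAD'S LEGS: `HRcol_translate` (block covariance of `Ga` + translation invariance of `Cm`), **`NlegRoad_inl_inr_coarse`**:
  `NlegRoad m a x ((m+1)•y₀) (inl κ) (inr l) = wH κ l (x − (m+1)•y₀)` modulo `h12 ∧ h126` (for `Spr (Ga (m+1) a)`, `spr_Ga_of_prop12`), i.e.
  **`= KInv x ((m+1)•y₀) (inl κ) (inr l)`** (`NlegRoad_inl_inr_coarse_eq_KInv`).
NOT HERE (honest): the ff read-out against `KKTFluctuationKernel.Gam` (`½Γ_R = Gam + ½·d𝔅δ-term` via `LandauDictionaryInstance.gam_Ga` — X₄∕K-R4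
border bookkeeping); the four sorted read-outs `fTL∕fTR∕fBL∕fBR (sortK n NlegK)` as `compF`-words (ρ-g6-6 «if cheap» — left to 3c part 3's
`periodise_sortK_comp`); 3c's torus identities; any estimate uniform in `n`.

HONEST FRAMING (cell contract, verbatim): «discharging `BetaPertH` makes Bałaban's UV stability UNCONDITIONAL — a real constructive-QFT
result; it is NOT the continuum limit and NOT the Clay problem.»  HONEST DEPENDENCY (verbatim): «continuum YM on T⁴ ⇐ BetaPertH ∧ nine
spine estimates (0/9 proved); BetaPertH ⇐ (D1) ∧ (D4) ∧ CAP+tail; G-an2-4 gates asym, D1 and NE2/3/4.»  [folklore] kernel bookkeeping over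
PARTS 1–2 and the named modules; the road-leg statements are conditional ONLY on the two PRINTED statements `B5.Prop12Printed` ∕
`B5.Kernel126_127Printed` (the road's standing `h12`∕`h126`, quoted defs — nothing new); no `Prop` is minted, nothing is cited, 0 sorry.
0∕4 binders; (K) NOT closed; NOT D1, NOT BetaPertH, NOT summit progress.  ABSOLUTE RULE (cell, verbatim): «No internally-minted statement may
enter as a cited fact. Every hypothesis is either kernel-proved in this package or a verbatim quotation of a PUBLISHED theorem with page
reference. The manuscript(s) under audit are NOT citable for their own disputed steps — they are the thing under adjudication;
programme-internal (2001/route/tribunal) claims are never citable.»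
Provenance: NE9 formalisation swarm leaf prover `b2b-balaban-t4-ne9-formalise-leaf-06` (gen 29), cross-row brick «K-3b-P», 2026-08-20.
-/

noncomputable section

namespace Summit.QuantumFields.BalabanUV.Beta.D1BFx.RWeightedLegPack

open Literature.Probability.LatticeModels (TorusSite Torus.proj)
open Literature.MathematicalPhysics.QuantumFieldTheory.LatticeForm (quo proj_add_zsmul)
open Literature.MathematicalPhysics.QuantumFieldTheory.Balaban1983to89
open Literature.MathematicalPhysics.QuantumFieldTheory.Balaban1983to89.Beta
open BlochFibreUniqueness (quo_add_zsmul)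
open AffineAveraging (Form1)
open AffineReproduction (contourSumAdj)
open KKTFluctuationKernel (delta1)
open KKTFluctuationEnergy (lip1 lip1_contourSumAdj)
open KernelSpecInstance (wH wΦ contourSumAdj_shift)
open ExpKernelCalculus (MKer Decays comp shiftK)
open OneStepResolventKernel (Fib KInv KInv_inl_inr_coarse proj_zsmul quo_zsmul eq_zsmul_quo_of_proj)
open VectorTailsLoc (fam kfam)
open Summit.QuantumFields.BalabanUV.Beta.TameKernelCalculus (Spr trK trK_apply)
open Summit.QuantumFields.BalabanUV.Beta.BorderedHessian (bhK bhK_inr_inl summable_delta1 lip1_delta1_left)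
open Summit.QuantumFields.BalabanUV.Beta.D1BFx.PackedKernelSplit (blk packK)
open Summit.QuantumFields.BalabanUV.Beta.D1BFx.LandauDictionaryH (HRcol HRcol_apply abs_Cun_le)
open Summit.QuantumFields.BalabanUV.Beta.D1BFx.LandauResolventSuperpositionRight (wH_eq_HRcol_of_X1a)
open Summit.QuantumFields.BalabanUV.Beta.D1BFx.LandauDictionaryInstance (hX1a_Ga)
open Summit.QuantumFields.BalabanUV.Beta.D1BFx.CoarseGramInverse (multM multM_apply multM_translate spr_multM)
open Summit.QuantumFields.BalabanUV.Beta.D1BFx.GluonLeg (Ga_symm shiftK_Ga)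
open Summit.QuantumFields.BalabanUV.Beta.D1BFx.GluonLegTails (spr_Ga_of_prop12)
open Summit.QuantumFields.BalabanUV.Beta.D1BFx.FrozenLegTails (nOf MOf hn1)
open scoped BigOperators

variable (n : ℕ) [NeZero n]

/-! ## §1 In the fm slot only `ℋ_R` survives -/

section Vanish
variable {Ga Cm : MKer 4 (Fin 4)}

omit [NeZero n] in
/-- [folklore] A composition whose LEFT factor has no field rows at `(x, κ)` has none either. -/
theorem comp_inl_row_zero {A K : MKer 4 (Fib 3)} {x : Fin 4 → ℤ} {κ : Fin 4} (hA : ∀ z f, A x z (Sum.inl κ) f = 0)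
    (w : Fin 4 → ℤ) (b : Fib 3) : comp A K x w (Sum.inl κ) b = 0 := by
  simp only [ExpKernelCalculus.comp, hA, zero_mul, Finset.sum_const_zero, tsum_zero]

omit [NeZero n] in
/-- [folklore] The sandwich has no fm entries (its right factor `Qp ∘ Gp` has no multiplier columns). -/
theorem sandP_inl_inr (x w : Fin 4 → ℤ) (κ l : Fin 4) : sandP n Ga Cm x w (Sum.inl κ) (Sum.inr l) = 0 :=
  comp_inr_col_off (comp_inr_col_off (fun z f l => by cases f <;> rfl)) x _ l

omit [NeZero n] in
/-- [folklore] `ℋ♭_R` has no fm entries (its left factor `Cp` has no field rows). -/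
theorem HRbp_inl_inr (x w : Fin 4 → ℤ) (κ l : Fin 4) : HRbp n Ga Cm x w (Sum.inl κ) (Sum.inr l) = 0 :=
  comp_inl_row_zero (fun z f => by cases f <;> rfl) w _

omit [NeZero n] in
/-- [folklore] **IN THE fm SLOT ONLY `ℋ_R` SURVIVES**: `NlegK x w (inl κ) (inr l) = HRp x w (inl κ) (inr l)`. -/
theorem NlegK_inl_inr_eq_HRp (a' : ℝ) (x w : Fin 4 → ℤ) (κ l : Fin 4) :
    NlegK n Ga Cm a' x w (Sum.inl κ) (Sum.inr l) = HRp n Ga Cm x w (Sum.inl κ) (Sum.inr l) := by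
  simp only [NlegK, Pi.add_apply, Pi.sub_apply, Pi.smul_apply, smul_eq_mul, Gp_inl_inr, sandP_inl_inr, HRbp_inl_inr, Cp_inl_inr,
    sub_zero, mul_zero, zero_add, add_zero]

end Vanish

/-! ## §2 The inner weight `(Qpᵀ ∘ Cp)(z, w; inl m, inr l) = (𝒬ᵀ Cm-column)(m, z)` -/

section Inner
variable {Cm : MKer 4 (Fin 4)}

omit [NeZero n] in
/-- [folklore] Off the sublattice in the column variable the inner weight vanishes. -/
theorem trKQp_Cp_inl_inr_off {w : Fin 4 → ℤ} (hw : Torus.proj n w ≠ 0) (z : Fin 4 → ℤ) (m l : Fin 4) :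
    comp (trK (Qp n)) (Cp n Cm) z w (Sum.inl m) (Sum.inr l) = 0 :=
  comp_inr_col_off (fun u f l => by
    cases f
    · rfl
    · exact embC_col_off n Cm u hw _ l) z _ l

/-- [folklore] Multiples of `n` are an injective image of `ℤ⁴` in `ℤ⁴`. -/
theorem zsmul_injective : Function.Injective fun y : Fin 4 → ℤ => (n : ℤ) • y := by
  intro y y' h
  have hn : (n : ℤ) ≠ 0 := by exact_mod_cast NeZero.ne n
  exact smul_right_injective (Fin 4 → ℤ) hn h

/-- [folklore] **THE INNER WEIGHT AT A COARSE COLUMN**: for `w ∈ n•ℤ⁴` and a decaying coarse kernel `Cm`,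
`(Qpᵀ ∘ Cp)(z, w; inl m, inr l) = contourSumAdj n (fun m′ y => Cm y (quo n w) m′ l) m z` — the coarse-to-fine weight `𝒬ᵀ` of the `(l, w∕n)`-column of
`Cm` (the fine sum over `u` lives on the sublattice; re-indexed by `u = n•y` it is the adjointness pairing `⟨𝒬δ_{(m,z)}, Cm-column⟩`). -/
theorem trKQp_Cp_inl_inr {C δ : ℝ} (hCm : Decays Cm C δ) (hδ : 0 ≤ δ) {w : Fin 4 → ℤ} (hw : Torus.proj n w = 0)
    (z : Fin 4 → ℤ) (m l : Fin 4) :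
    comp (trK (Qp n)) (Cp n Cm) z w (Sum.inl m) (Sum.inr l) = contourSumAdj n (fun m' y => Cm y (quo n w) m' l) m z := by
  -- the summand, as a function of the fine intermediate point `u`
  set F : (Fin 4 → ℤ) → ℝ := fun u =>
    ∑ m' : Fin 4, (if Torus.proj n u = 0 then AffineAveraging.contourSum n (delta1 m z) m' (quo n u) else 0) * embC n Cm u w m' l with hF
  have e1 : comp (trK (Qp n)) (Cp n Cm) z w (Sum.inl m) (Sum.inr l) = ∑' u : Fin 4 → ℤ, F u := by
    simp only [ExpKernelCalculus.comp, Fintype.sum_sum_type, trK_apply, Qp_inl_inl, Cp_inl_inr, mul_zero, Finset.sum_const_zero, zero_add,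
      Qp_inr_inl, bhK_inr_inl, Cp_inr_inr, hF]
  -- its support lies on the sublattice
  have hsupp : Function.support F ⊆ Set.range fun y : Fin 4 → ℤ => (n : ℤ) • y := by
    intro u hu
    by_cases hpu : Torus.proj n u = 0
    · exact ⟨quo n u, (eq_zsmul_quo_of_proj (N := n) hpu).symm⟩
    · exfalso
      apply hu
      simp only [hF, hpu, if_false, zero_mul, Finset.sum_const_zero]
  -- read on the sublattice
  have e2 : ∀ y : Fin 4 → ℤ, F ((n : ℤ) • y) = ∑ m' : Fin 4, (fun m' y => Cm y (quo n w) m' l) m' y * AffineAveraging.contourSum n (delta1 m z) m' y := by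
    intro y
    simp only [hF, proj_zsmul, quo_zsmul, if_true, embC_apply, hw, and_self, if_true]
    exact Finset.sum_congr rfl fun m' _ => mul_comm _ _
  -- boundedness of the coarse column (for the adjointness lemma)
  have hφ : ∀ m' y, |(fun m' y => Cm y (quo n w) m' l) m' y| ≤ C := fun m' y => abs_Cun_le hCm hδ l (quo n w) m' y
  rw [e1, ← Function.Injective.tsum_eq (zsmul_injective n) hsupp]
  simp only [e2]
  rw [← lip1_contourSumAdj (N := n) (fun κ => summable_delta1 m z κ) hφ, lip1_delta1_left]

end Inner

/-! ## §3 The fm and mf blocks of the N-leg are `HRcol` -/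

section ReadOut
variable {Ga Cm : MKer 4 (Fin 4)}

/-- [folklore] **`ℋ_R` READ OUT**: `HRp n Ga Cm x w (inl κ) (inr l) = HRcol n Ga Cm l (quo n w) κ x` at coarse columns `w ∈ n•ℤ⁴`, `0` elsewhere
(decay of `Cm` only — it bounds the coarse column inside the adjointness step). -/
theorem HRp_inl_inr {C δ : ℝ} (hCm : Decays Cm C δ) (hδ : 0 ≤ δ) (x w : Fin 4 → ℤ) (κ l : Fin 4) :
    HRp n Ga Cm x w (Sum.inl κ) (Sum.inr l) = if Torus.proj n w = 0 then HRcol n Ga Cm l (quo n w) κ x else 0 := by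
  have e1 : HRp n Ga Cm x w (Sum.inl κ) (Sum.inr l)
      = ∑' z : Fin 4 → ℤ, ∑ m : Fin 4, Gp Ga x z (Sum.inl κ) (Sum.inl m) * comp (trK (Qp n)) (Cp n Cm) z w (Sum.inl m) (Sum.inr l) := by
    simp only [HRp, ExpKernelCalculus.comp, Fintype.sum_sum_type, Gp_inl_inr, zero_mul, Finset.sum_const_zero, add_zero]
  rw [e1]
  by_cases hw : Torus.proj n w = 0
  · rw [if_pos hw, HRcol_apply]
    refine tsum_congr fun z => Finset.sum_congr rfl fun m _ => ?_
    rw [Gp_inl_inl, trKQp_Cp_inl_inr n hCm hδ hw]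
  · rw [if_neg hw]
    simp only [trKQp_Cp_inl_inr_off n hw, mul_zero, Finset.sum_const_zero, tsum_zero]

/-- [folklore] **THE fm BLOCK OF THE PACKED N-LEG IS THE R-WEIGHTED MINIMISER COLUMN**:
`NlegK n Ga Cm a′ x w (inl κ) (inr l) = HRcol n Ga Cm l (quo n w) κ x` at coarse `w`, `0` off the sublattice. -/
theorem NlegK_inl_inr {C δ : ℝ} (hCm : Decays Cm C δ) (hδ : 0 ≤ δ) (a' : ℝ) (x w : Fin 4 → ℤ) (κ l : Fin 4) :
    NlegK n Ga Cm a' x w (Sum.inl κ) (Sum.inr l) = if Torus.proj n w = 0 then HRcol n Ga Cm l (quo n w) κ x else 0 := by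
  rw [NlegK_inl_inr_eq_HRp, HRp_inl_inr n hCm hδ]

/-- [folklore] The same at an explicit coarse column `w = n•y₀`. -/
theorem NlegK_inl_inr_coarse {C δ : ℝ} (hCm : Decays Cm C δ) (hδ : 0 ≤ δ) (a' : ℝ) (x y₀ : Fin 4 → ℤ) (κ l : Fin 4) :
    NlegK n Ga Cm a' x ((n : ℤ) • y₀) (Sum.inl κ) (Sum.inr l) = HRcol n Ga Cm l y₀ κ x := by
  rw [NlegK_inl_inr n hCm hδ, if_pos (proj_zsmul (N := n) y₀), quo_zsmul]

/-- [folklore] **THE mf BLOCK IS THE TRANSPOSE** (symmetric spread `Ga`, `Cm`; `trK_NlegK`):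
`NlegK n Ga Cm a′ w x (inr l) (inl κ) = HRcol n Ga Cm l (quo n w) κ x` at coarse `w`, `0` elsewhere. -/
theorem NlegK_inr_inl (hGaSymm : ∀ x z κ m, Ga x z κ m = Ga z x m κ) (hCmSymm : ∀ y y' m l, Cm y y' m l = Cm y' y l m)
    (hGa : Spr Ga) (hCm : Spr Cm) (a' : ℝ) (w x : Fin 4 → ℤ) (l κ : Fin 4) :
    NlegK n Ga Cm a' w x (Sum.inr l) (Sum.inl κ) = if Torus.proj n w = 0 then HRcol n Ga Cm l (quo n w) κ x else 0 := by
  obtain ⟨C, δ, hδ, hdec⟩ := hCm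
  have h := congrFun (congrFun (congrFun (congrFun (trK_NlegK n hGaSymm hCmSymm hGa ⟨C, δ, hδ, hdec⟩ a') w) x) (Sum.inr l)) (Sum.inl κ)
  rw [trK_apply] at h
  rw [← h, NlegK_inl_inr n hdec hδ.le]

end ReadOut

/-! ## §4 At the road's legs: the fm block of the N-leg is the fm block of `KInv` -/

section Road

/-- [folklore] **TRANSLATION OF `HRcol`**: for a block-covariant `Ga` (`shiftK (n•t) Ga = Ga`) and a translation-invariant coarse `Cm`,
`HRcol n Ga Cm l y₀ κ x = HRcol n Ga Cm l 0 κ (x − n•y₀)` (re-index the fine sum by `z ↦ z + n•y₀`; `contourSumAdj_shift`). -/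
theorem HRcol_translate {Ga Cm : MKer 4 (Fin 4)} (hGa : ∀ t : Fin 4 → ℤ, shiftK ((n : ℤ) • t) Ga = Ga)
    (hCm : ∀ (y y' v : Fin 4 → ℤ) (m l : Fin 4), Cm (y + v) (y' + v) m l = Cm y y' m l) (l : Fin 4) (y₀ : Fin 4 → ℤ) (κ : Fin 4)
    (x : Fin 4 → ℤ) : HRcol n Ga Cm l y₀ κ x = HRcol n Ga Cm l 0 κ (x - (n : ℤ) • y₀) := by
  -- the `(l, y₀)`-column of `Cm` is the translate of its `(l, 0)`-column, so its `𝒬ᵀ`-weight is the block translate (`contourSumAdj_shift`)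
  have hcol : (fun m' y => Cm y y₀ m' l) = fun m' y => (fun m'' q => Cm q 0 m'' l) m' (y - y₀) := by
    funext m' y
    have := hCm (y - y₀) 0 y₀ m' l
    rw [sub_add_cancel, zero_add] at this
    exact this
  have hshift : ∀ (m : Fin 4) (z : Fin 4 → ℤ), contourSumAdj n (fun m' y => Cm y y₀ m' l) m z
      = contourSumAdj n (fun m' y => Cm y 0 m' l) m (z - (n : ℤ) • y₀) := fun m z => by
    rw [hcol]
    exact contourSumAdj_shift (N := n) (fun m'' q => Cm q 0 m'' l) y₀ m z
  rw [HRcol_apply, HRcol_apply]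
  simp_rw [hshift]
  -- re-index the fine sum `z = z' + n•y₀`
  rw [← (Equiv.addRight ((n : ℤ) • y₀)).tsum_eq]
  refine tsum_congr fun z' => Finset.sum_congr rfl fun m _ => ?_
  simp only [Equiv.coe_addRight, add_sub_cancel_right]
  have e := congrFun (congrFun (congrFun (congrFun (hGa y₀) (x - (n : ℤ) • y₀)) z') κ) m
  simp only [shiftK, sub_add_cancel] at e
  rw [e]

variable (m : ℕ) {a : ℝ} (ha : 0 < a)
include ha

/-- [folklore] **AT THE ROAD'S LEGS THE fm BLOCK OF THE N-LEG IS `wH`** — MODULO [B5, Prop. 1.2] ∧ [B5, (1.126)–(1.127)] BY NAME (the road's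
standing `h12 ∧ h126`, for `Spr (Ga (m+1) a)` via `GluonLegTails.spr_Ga_of_prop12`; X₁a PROVED, `hX1a_Ga`; symmetry `Ga_symm`):
`NlegRoad m a x ((m+1)•y₀) (inl κ) (inr l) = wH κ l (x − (m+1)•y₀)` — the dictionary line (D-H) of K-R1-SPEC v2 §2 in packed form. -/
theorem NlegRoad_inl_inr_coarse (h12 : B5.Prop12Printed (fam nOf hn1 MOf a ha)) (h126 : B5.Kernel126_127Printed (kfam nOf MOf))
    (x y₀ : Fin 4 → ℤ) (κ l : Fin 4) :
    NlegRoad m a x (((m + 1 : ℕ) : ℤ) • y₀) (Sum.inl κ) (Sum.inr l) = wH (N := m + 1) κ l (x - ((m + 1 : ℕ) : ℤ) • y₀) := by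
  have hn : 1 ≤ m + 1 := Nat.le_add_left 1 m
  have hGa : Spr (GluonLeg.Ga (m + 1) a) := by
    obtain ⟨C, δ, hδ, h⟩ := spr_Ga_of_prop12 ha h12 h126 (m + 1)
    exact ⟨C, δ, hδ, h⟩
  obtain ⟨CC, δC, hδC, hCm⟩ := spr_multM (m + 1) (2 * a / ((m + 1 : ℕ) : ℝ) ^ 8) 2
  rw [NlegRoad, NlegK_inl_inr_coarse (m + 1) hCm hδC.le,
    HRcol_translate (m + 1) (fun t => shiftK_Ga (m + 1) a hn t) (fun y y' v m' l' => multM_translate (m + 1) _ _ y y' v m' l') l y₀ κ x]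
  have hD := (wH_eq_HRcol_of_X1a (m + 1) a ha two_ne_zero two_ne_zero (GluonLeg.Ga (m + 1) a) hGa
    (fun x z κ' m' => Ga_symm (m + 1) a hn ha x z κ' m') (hX1a_Ga m ha) l).1
  have e := congrFun (congrFun hD κ) (x - ((m + 1 : ℕ) : ℤ) • y₀)
  rw [e]
  rfl

/-- [folklore] … i.e. **THE fm BLOCK OF THE ROAD'S N-LEG EQUALS THE fm BLOCK OF THE TYPED SHARP RESOLVENT `KInv (m+1)`** at every coarse
column (`OneStepResolventKernel.KInv_inl_inr_coarse`), modulo `h12 ∧ h126`. -/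
theorem NlegRoad_inl_inr_coarse_eq_KInv (h12 : B5.Prop12Printed (fam nOf hn1 MOf a ha))
    (h126 : B5.Kernel126_127Printed (kfam nOf MOf)) (x y₀ : Fin 4 → ℤ) (κ l : Fin 4) :
    NlegRoad m a x (((m + 1 : ℕ) : ℤ) • y₀) (Sum.inl κ) (Sum.inr l)
      = KInv (N := m + 1) (d := 3) x (((m + 1 : ℕ) : ℤ) • y₀) (Sum.inl κ) (Sum.inr l) := by
  rw [NlegRoad_inl_inr_coarse m ha h12 h126, KInv_inl_inr_coarse]

end Road

end Summit.QuantumFields.BalabanUV.Beta.D1BFx.RWeightedLegPack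

end
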